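import Literature.Analysis.FluidPDE.NormalisedPressure
import Literature.Analysis.FluidPDE.LerayHopf
import Literature.Analysis.FluidPDE.NSWave0
import Literature.Analysis.FluidPDE.SuitableWeak
import HarnessLib

/-!
# Seregin–Šverák 2002: one-sided bounds on the normalised pressure exclude blow-up (named facts)

Literature/Analysis/FluidPDE facts file for the cite item `wi-10844` (route
NavierStokesRegularity/HiddenConvexityPressureFloor, crux `SereginSverakFloorExtension` =
stmt-NavierStokesRegularity-2963; also stmt-2965 `UniformModulusNoBlowup` and the head-pressure idea
cards), vendoring

* G. Seregin, V. Šverák, *Navier–Stokes equations with lower bounds on the pressure*, Arch. Ration.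
  Mech. Anal. **163** (2002) 65–86, doi:10.1007/s002050200199 [SereginSverak2002].

**The printed result** (abstract, verbatim): "We prove that weak solutions of the three-dimensional
incompressible Navier–Stokes equations are smooth if the negative part of the pressure is
controlled, or if the positive part of the quantity `|v|² + 2p` is controlled." Here `v` is a weak
Leray–Hopf solution of the Cauchy problem for the unforced system on `ℝ³ × ]0,T[` and `p` is the
NORMALISED pressure `p = RᵢRⱼ(vᵢvⱼ) = (1/4π)∫|x-y|⁻¹ div div (v ⊗ v)(y) dy` (the convention is
printed in the companion paper [SereginSverak2002BU], (2.7), which cites the ARMA paper, its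
ref. [17], for it and for the partial-regularity input (3.1) at a singular point); "controlled"
means majorised, `p ≥ -g` resp. `|v|² + 2p ≤ g`, by a nonnegative `g` in the paper's admissible
(parabolic-Morrey-type) class, and the conclusion is Hölder continuity (hence smoothness) of `v` on
`ℝ³ × ]0, T]`, i.e. NO SINGULAR POINT UP TO AND INCLUDING THE FINAL TIME `T`.

**Source status.** The ARMA paper is cite-only on this hub (acquisition `acq-01580`: no open copy;
zbMATH review withheld). What is vendored below is therefore ONLY the special case that every
secondary source read for this file states, the BOUNDED case `g ≡ M` (a constant):
Moffatt–Kimura [MoffattKimura2018, §1, arXiv p. 3]: "[Seregin & Šverák 2002] have proved that if a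
finite-time singularity of the Navier–Stokes equations occurs at time `t = t_c`, then the pressure
field `p(x, t)` is unbounded below"; Miller [Miller2021Growth, §1]: "Seregin and Šverák showed that in
order for a solution of the Navier–Stokes equation to blowup in finite-time, then `p` must become
unbounded below and `p + ½|u|²` must become unbounded above"; the by-product Lemma 3.3 of the paper
(the `A`-criterion `sup_{0<R<R*} A(v,R) < ε*` ⇒ regular, backward cylinders) is restated with its
number in [BarkerWang2023, §3 Lemma 1] and used in [SereginSverak2002BU, (3.1)] and
Robinson–Rodrigo–Sadowski 2016 (held, PDF p. 249). The general `g`-class (its exact parabolic-Morrey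
condition and the theorem number) is deliberately NOT rendered: it could not be read, and a guessed
class would risk over-claiming. When `acq-01580` is fulfilled the general statement should be
APPENDED here (new name), not substituted.

## Rendering (why these hypotheses)

The facts are rendered for the tree's CLASSICAL finite-energy class on `[0, T)` — exactly the class
of the consumers — which lies inside the paper's class under every reading of its standing
assumptions, so that the rendered statements are special cases of the printed one:

* `IsClassicalNSSolutionOn (Ico 0 T) ν 0 u p`: `(u, p)` jointly `C^∞` on `[0,T) × ℝ³`, unforced
  Navier–Stokes pointwise; in particular `(u, p)` is a suitable weak solution on every open
  sub-cylinder (local energy EQUALITY), so no suitability proviso of the paper can fail;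
* `IsLerayHopfOn T ν 0 (u 0) u`: `u` is a weak Leray–Hopf solution of the Cauchy problem on
  `[0, T)` in the strict sense (energy inequality, weak `L²` continuity on `(0, T]`, datum attained
  strongly) — the paper's solution class;
* `HasRapidSpatialDecay (u 0)`: the datum is smooth with all derivatives decaying faster than any
  polynomial (Fefferman's (4)), hence lies in `L² ∩ H¹ ∩ Lᵖ` for every `p` — inside any data class
  (`L₂`-solenoidal, `W¹₂`, …) the paper may impose;
* the one-sided bound is imposed at EVERY `(t, x) ∈ (0,T) × ℝ³` on the tree's pointwise
  `normalisedPressure (u t) x` (principal-value realisation of `RᵢRⱼ(uᵢuⱼ)`, `NormalisedPressure.lean`;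
  on the admissible locus — a.e., indeed everywhere for these smooth `L²` slices — it is the paper's
  `p`), which implies the paper's a.e. hypothesis on `ℝ³ × ]0,T[`;
* the conclusion is rendered as LOCAL BOUNDEDNESS of `u` near every point of the final slice
  `{T} × ℝ³` through backward cylinders `(t₀ - r², t₀) × B(x₀, r)` (only times `< T` enter), for
  every `t₀ ∈ (0, T]` — weaker than the printed Hölder continuity on `ℝ³ × ]0,T]` (a function Hölder
  continuous on the closed cylinder is bounded on it, and `u` is the continuous representative for
  `t < T`). This is the tree's notion of a regular point in backward form (compare
  `IsRegularPoint`, centred cylinders, and `parabolicCylinder`); the `L^∞(Q_r)` form is the proved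
  corollary `eLpNorm_parabolicCylinder_lt_top`.
* Viscosity: printed for `ν = 1`; `ν > 0` by the symmetry `v(s, x) = ν⁻¹ u(s/ν, x)`,
  `q(s, x) = ν⁻² p(s/ν, x)` (a `ν = 1` solution on `[0, νT)`; `p̃` is 2-homogeneous in `u`,
  `normalisedPressure_smul`, so a constant one-sided bound stays a constant one-sided bound), as in
  the accepted `tao_pressure_normalisation`.

What the consumers still have to do (NOT part of the fact, as the route planned): regularity up to
`T` near each point ⇒ `u ∈ L^∞` on `(T-δ, T) × K` for compact `K`; CKN ε-regularity far out (tails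
of the energy) ⇒ `u` bounded on `ℝ³ × (T-δ, T)` ⇒ Ladyzhenskaya–Prodi–Serrin continuation
(`r = ∞`) ⇒ `HasSmoothExtensionPast ν 0 u T`.

## Contents

* `IsBackwardBoundedAt u t₀ x₀` — `u` bounded on some backward cylinder `(t₀ - r², t₀) × B(x₀, r)`
  (definition; proved API: `eLpNorm_parabolicCylinder_lt_top`, `of_le`, and `of_continuousOn` —
  a field continuous on `[0,T) × ℝ³` is backward bounded at every interior time, so the content of
  the fact is at `t₀ = T`).
* `SereginSverak2002_pressureOneSidedBound` — ONE named fact (nothing asserted) carrying the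
  abstract's disjunction: (b) `p̃ ≥ -M` or (a) `|u|² + 2p̃ ≤ M` on `(0,T) × ℝ³` ⇒ no singular point
  in `(0, T] × ℝ³`.
* Proved corollaries: the two cases separately (`.of_lowerBound`, `.of_headUpperBound`), the
  `Ico`-hypothesis form the route decl uses (`.of_lowerBound_Ico`), the final-time specialisation
  (`.at_top`), and the essential-boundedness form on the backward parabolic cylinder
  (`.eLpNorm_lt_top`).

## Mathlib / tree search

`lean search`: `normalisedPressure`, `HasNormalisedPressure` (tree, used); `IsLerayHopfOn`,
`IsClassicalNSSolutionOn`, `HasRapidSpatialDecay`, `HasSmoothExtensionPast` (tree, used / consumer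
side); `IsRegularPoint`, `parabolicCylinder`, `IsBackwardSingularPoint` (tree; the backward
boundedness conclusion below is the negation pattern of the latter, stated without importing
`LocalTypeI`); `headPressure` (tree, Tsai's self-similar head `½|U|² + P + a⟪y,U⟫` — a different
object, not used); nothing on Seregin–Šverák 2002 itself (`SereginSverak2002` occurs only in route
files).

## References

* [SereginSverak2002] G. Seregin, V. Šverák, ARMA 163 (2002) 65–86 — abstract (main theorem), Lemma 3.3.
* [SereginSverak2002BU] G. Seregin, V. Šverák, *The Navier–Stokes equations and backward
  uniqueness* (2002), (2.7) and (3.1) (IMA preprint text read).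
* [MoffattKimura2018] §1; [Miller2021Growth] §1; [BarkerWang2023] §3 Lemma 1 (secondary statements read).
* J. C. Robinson, J. L. Rodrigo, W. Sadowski, *The three-dimensional Navier–Stokes equations*
  (CUP 2016), §16.4, sketch of the proof of Thm. 16.5, Step 3, PDF p. 249 ("Following Seregin &
  Šverák (2002) there exist `R_k → 0` such that …" — the backward-cylinder blow-up criterion).
-/

noncomputable section

open _root_.MeasureTheory Set Metric Function
open scoped ENNReal

namespace Literature.Analysis.FluidPDE

/-- Local notation for physical space `ℝ³ = EuclideanSpace ℝ (Fin 3)`. -/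
local notation "ℝ³" => EuclideanSpace ℝ (Fin 3)

/-- **Backward local boundedness at a space–time point** (the conclusion shape of the facts below):
`u` is bounded on some backward cylinder `(t₀ - r², t₀) × B(x₀, r)`, `r > 0` — only times `< t₀`
enter, so at `t₀ = T` this is regularity "up to `T`" for a solution living on `[0, T)`
(Caffarelli–Kohn–Nirenberg 1982, §6: a point is regular if `u` is bounded in a parabolic
neighbourhood; backward cylinders as in `parabolicCylinder`). [folklore] -/
def IsBackwardBoundedAt (u : ℝ → ℝ³ → ℝ³) (t₀ : ℝ) (x₀ : ℝ³) : Prop :=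
  ∃ r > 0, ∃ C : ℝ, ∀ t ∈ Ioo (t₀ - r ^ 2) t₀, ∀ x ∈ ball x₀ r, ‖u t x‖ ≤ C

/-- **Seregin–Šverák 2002, main theorem ("lower bounds on the pressure"), bounded majorant.**
Let `ν > 0`, `T > 0`, and let `(u, p)` be a classical solution of the unforced Navier–Stokes system
on `ℝ³ × [0, T)` which is a weak Leray–Hopf solution of the Cauchy problem on `[0, T)` with smooth
rapidly decaying datum `u 0`. Suppose that for some constant `M` EITHER (b) the normalised pressure
`p̃ = RᵢRⱼ(uᵢuⱼ)` (`normalisedPressure (u t)`) is bounded below, `p̃(t, x) ≥ -M`, OR (a) the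
(doubled) Bernoulli head is bounded above, `|u(t, x)|² + 2 p̃(t, x) ≤ M`, for all `t ∈ (0, T)`,
`x ∈ ℝ³` ("the negative part of the pressure is controlled, or the positive part of the quantity
`|v|² + 2p` is controlled"). Then `u` has no singular point in `(0, T] × ℝ³`: for every
`t₀ ∈ (0, T]` and `x₀ ∈ ℝ³`, `u` is bounded on some backward cylinder `(t₀ - r², t₀) × B(x₀, r)`
— in particular no blow-up at `t = T`. This is the special case `g ≡ M` of the printed theorem
(majorant `g ≥ 0` in a parabolic-Morrey-type class; conclusion printed as Hölder continuity of `v`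
on `ℝ³ × ]0, T]`); printed for `ν = 1`, general `ν > 0` by scaling. Nothing asserted; users take
`(h : SereginSverak2002_pressureOneSidedBound)`.
[cite: SereginSverak2002, Main Theorem as stated in the abstract – bounded case g ≡ M] -/
def SereginSverak2002_pressureOneSidedBound : Prop :=
  ∀ (ν T : ℝ), 0 < ν → 0 < T →
    ∀ (u : ℝ → ℝ³ → ℝ³) (p : ℝ → ℝ³ → ℝ),
      IsClassicalNSSolutionOn (Ico 0 T) ν 0 u p →
      IsLerayHopfOn T ν 0 (u 0) u →
      HasRapidSpatialDecay (u 0) →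
      (∃ M : ℝ, (∀ t ∈ Ioo 0 T, ∀ x : ℝ³, -M ≤ normalisedPressure (u t) x) ∨
        (∀ t ∈ Ioo 0 T, ∀ x : ℝ³, ‖u t x‖ ^ 2 + 2 * normalisedPressure (u t) x ≤ M)) →
      ∀ t₀ ∈ Ioc 0 T, ∀ x₀ : ℝ³, IsBackwardBoundedAt u t₀ x₀

/-! ### Proved consequences -/

namespace IsBackwardBoundedAt

variable {u : ℝ → ℝ³ → ℝ³} {t₀ : ℝ} {x₀ : ℝ³}

/-- Backward boundedness gives essential boundedness on the backward parabolic cylinder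
`Q_r(t₀, x₀) = (t₀ - r², t₀) × B_r(x₀)` of the tree (`parabolicCylinder`), i.e. the `L^∞(Q_r)`
form of "regular point" (CKN 1982, §6). [folklore] -/
theorem eLpNorm_parabolicCylinder_lt_top (h : IsBackwardBoundedAt u t₀ x₀) :
    ∃ r > 0, eLpNorm (uncurry u) ∞ (volume.restrict (parabolicCylinder r (t₀, x₀))) < ∞ := by
  obtain ⟨r, hr, C, hC⟩ := h
  refine ⟨r, hr, ?_⟩
  have hbound : ∀ᵐ z ∂(volume.restrict (parabolicCylinder r (t₀, x₀))), ‖uncurry u z‖ ≤ C := by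
    rw [ae_restrict_iff' (isOpen_parabolicCylinder r (t₀, x₀)).measurableSet]
    refine Filter.Eventually.of_forall fun z hz ↦ ?_
    rw [mem_parabolicCylinder] at hz
    exact hC z.1 hz.1 z.2 (mem_ball.2 hz.2)
  calc eLpNorm (uncurry u) ∞ (volume.restrict (parabolicCylinder r (t₀, x₀)))
      ≤ ENNReal.ofReal C := by
        rw [eLpNorm_exponent_top]
        exact eLpNormEssSup_le_of_ae_bound hbound
    _ < ∞ := ENNReal.ofReal_lt_top

/-- Shrinking the radius preserves backward boundedness. [folklore] -/
theorem of_le {r r' C : ℝ} (hr' : 0 < r') (hle : r' ≤ r)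
    (hC : ∀ t ∈ Ioo (t₀ - r ^ 2) t₀, ∀ x ∈ ball x₀ r, ‖u t x‖ ≤ C) :
    IsBackwardBoundedAt u t₀ x₀ := by
  refine ⟨r', hr', C, fun t ht x hx ↦ hC t ⟨?_, ht.2⟩ x (ball_subset_ball hle hx)⟩
  have : r' ^ 2 ≤ r ^ 2 := pow_le_pow_left₀ hr'.le hle 2
  linarith [ht.1]

/-- A field continuous on `[0, T) × ℝ³` (e.g. the velocity of a classical solution on `Ico 0 T`)
is backward bounded at every INTERIOR time `t₀ ∈ (0, T)`: the content of the fact is at `t₀ = T`.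
[folklore] -/
theorem of_continuousOn {T : ℝ} (hu : ContinuousOn (uncurry u) (Ico 0 T ×ˢ univ))
    (ht₀ : t₀ ∈ Ioo 0 T) (x₀ : ℝ³) : IsBackwardBoundedAt u t₀ x₀ := by
  -- a compact box `[t₀ - r², (t₀ + T)/2] × closedBall x₀ 1` inside `[0, T) × ℝ³`
  obtain ⟨ht₀0, ht₀T⟩ := ht₀
  set r : ℝ := min 1 (Real.sqrt t₀ / 2) with hr
  have hr0 : 0 < r := lt_min one_pos (by positivity)
  have hr2 : r ^ 2 < t₀ := by
    have h1 : r ≤ Real.sqrt t₀ / 2 := min_le_right _ _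
    have h2 : (Real.sqrt t₀ / 2) ^ 2 = t₀ / 4 := by
      rw [div_pow, Real.sq_sqrt ht₀0.le]; norm_num
    calc r ^ 2 ≤ (Real.sqrt t₀ / 2) ^ 2 := pow_le_pow_left₀ hr0.le h1 2
      _ = t₀ / 4 := h2
      _ < t₀ := by linarith
  set K : Set (ℝ × ℝ³) := Icc (t₀ - r ^ 2) t₀ ×ˢ closedBall x₀ r with hK
  have hKc : IsCompact K := isCompact_Icc.prod (isCompact_closedBall x₀ r)
  have hKsub : K ⊆ Ico 0 T ×ˢ univ := by
    rintro ⟨t, x⟩ ⟨⟨ht1, ht2⟩, -⟩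
    exact ⟨⟨by linarith, lt_of_le_of_lt ht2 ht₀T⟩, mem_univ _⟩
  obtain ⟨C, hC⟩ := (hKc.image_of_continuousOn (hu.mono hKsub)).isBounded.exists_norm_le
  refine ⟨r, hr0, C, fun t ht x hx ↦ hC (uncurry u (t, x)) ⟨(t, x), ⟨?_, ?_⟩, rfl⟩⟩
  · exact ⟨ht.1.le, ht.2.le⟩
  · exact ball_subset_closedBall hx

end IsBackwardBoundedAt

namespace SereginSverak2002_pressureOneSidedBound

variable {ν T : ℝ} {u : ℝ → ℝ³ → ℝ³} {p : ℝ → ℝ³ → ℝ}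

/-- **Case (b), pressure floor**: `p̃ ≥ -M` on `(0, T) × ℝ³` ⇒ no singular point in `(0, T] × ℝ³`.
PROVED from the named fact. [cite: SereginSverak2002, Main Theorem (abstract) – case p ≥ -g] -/
theorem of_lowerBound (h : SereginSverak2002_pressureOneSidedBound) (hν : 0 < ν) (hT : 0 < T)
    (hs : IsClassicalNSSolutionOn (Ico 0 T) ν 0 u p) (hLH : IsLerayHopfOn T ν 0 (u 0) u)
    (hd : HasRapidSpatialDecay (u 0))
    (hM : ∃ M : ℝ, ∀ t ∈ Ioo 0 T, ∀ x : ℝ³, -M ≤ normalisedPressure (u t) x) :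
    ∀ t₀ ∈ Ioc 0 T, ∀ x₀ : ℝ³, IsBackwardBoundedAt u t₀ x₀ := by
  obtain ⟨M, hM⟩ := hM
  exact h ν T hν hT u p hs hLH hd ⟨M, Or.inl hM⟩

/-- **Case (a), head ceiling**: `|u|² + 2p̃ ≤ M` on `(0, T) × ℝ³` ⇒ no singular point in
`(0, T] × ℝ³`. PROVED from the named fact.
[cite: SereginSverak2002, Main Theorem (abstract) – case |v|² + 2p ≤ g] -/
theorem of_headUpperBound (h : SereginSverak2002_pressureOneSidedBound) (hν : 0 < ν) (hT : 0 < T)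
    (hs : IsClassicalNSSolutionOn (Ico 0 T) ν 0 u p) (hLH : IsLerayHopfOn T ν 0 (u 0) u)
    (hd : HasRapidSpatialDecay (u 0))
    (hM : ∃ M : ℝ, ∀ t ∈ Ioo 0 T, ∀ x : ℝ³, ‖u t x‖ ^ 2 + 2 * normalisedPressure (u t) x ≤ M) :
    ∀ t₀ ∈ Ioc 0 T, ∀ x₀ : ℝ³, IsBackwardBoundedAt u t₀ x₀ := by
  obtain ⟨M, hM⟩ := hM
  exact h ν T hν hT u p hs hLH hd ⟨M, Or.inr hM⟩

/-- The pressure-floor case with the bound imposed on `[0, T)` — the hypothesis shape of the route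
decl `SereginSverakFloorExtension` (stmt-NavierStokesRegularity-2963): a bound on `Ico 0 T` is a
bound on `Ioo 0 T`. PROVED from the named fact. [cite: SereginSverak2002, Main Theorem (abstract)] -/
theorem of_lowerBound_Ico (h : SereginSverak2002_pressureOneSidedBound) (hν : 0 < ν) (hT : 0 < T)
    (hs : IsClassicalNSSolutionOn (Ico 0 T) ν 0 u p) (hLH : IsLerayHopfOn T ν 0 (u 0) u)
    (hd : HasRapidSpatialDecay (u 0))
    (hM : ∃ M : ℝ, ∀ t ∈ Ico 0 T, ∀ x : ℝ³, -M ≤ normalisedPressure (u t) x) :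
    ∀ t₀ ∈ Ioc 0 T, ∀ x₀ : ℝ³, IsBackwardBoundedAt u t₀ x₀ := by
  obtain ⟨M, hM⟩ := hM
  exact h.of_lowerBound hν hT hs hLH hd ⟨M, fun t ht x ↦ hM t (Ioo_subset_Ico_self ht) x⟩

/-- Final-time specialisation ("no blow-up at `T`"): under a pressure floor on `[0, T)`, `u` is
bounded near every point of the slice `t = T` through backward cylinders `(T - r², T) × B(x₀, r)`.
PROVED from the named fact. [cite: SereginSverak2002, Main Theorem (abstract)] -/
theorem at_top (h : SereginSverak2002_pressureOneSidedBound) (hν : 0 < ν) (hT : 0 < T)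
    (hs : IsClassicalNSSolutionOn (Ico 0 T) ν 0 u p) (hLH : IsLerayHopfOn T ν 0 (u 0) u)
    (hd : HasRapidSpatialDecay (u 0))
    (hM : ∃ M : ℝ, ∀ t ∈ Ico 0 T, ∀ x : ℝ³, -M ≤ normalisedPressure (u t) x) (x₀ : ℝ³) :
    ∃ r > 0, ∃ C : ℝ, ∀ t ∈ Ioo (T - r ^ 2) T, ∀ x ∈ ball x₀ r, ‖u t x‖ ≤ C :=
  h.of_lowerBound_Ico hν hT hs hLH hd hM T ⟨hT, le_rfl⟩ x₀

/-- Final-time regularity in the tree's `L^∞(Q_r)` vocabulary: `u ∈ L^∞((T - r², T) × B_r(x₀))`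
for some `r > 0`, at every `x₀` (the negation pattern of `IsBackwardSingularPoint u (T, x₀)` of
`LocalTypeI.lean`). PROVED from the named fact. [cite: SereginSverak2002, Main Theorem (abstract)] -/
theorem eLpNorm_lt_top (h : SereginSverak2002_pressureOneSidedBound) (hν : 0 < ν) (hT : 0 < T)
    (hs : IsClassicalNSSolutionOn (Ico 0 T) ν 0 u p) (hLH : IsLerayHopfOn T ν 0 (u 0) u)
    (hd : HasRapidSpatialDecay (u 0))
    (hM : ∃ M : ℝ, ∀ t ∈ Ico 0 T, ∀ x : ℝ³, -M ≤ normalisedPressure (u t) x) (x₀ : ℝ³) :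
    ∃ r > 0, eLpNorm (uncurry u) ∞ (volume.restrict (parabolicCylinder r (T, x₀))) < ∞ :=
  (h.of_lowerBound_Ico hν hT hs hLH hd hM T ⟨hT, le_rfl⟩ x₀).eLpNorm_parabolicCylinder_lt_top

end SereginSverak2002_pressureOneSidedBound

end Literature.Analysis.FluidPDE

end
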